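import Mathlib
import Literature.Probability.RandomPlanarGeometry.HexParafermion
import Literature.Probability.RandomPlanarGeometry.HexSAW
import Summits.CriticalPhenomena.SAWScalingLimit.Theses.SAWDevelopingMap

/-!
# Sketch (ideator 3, gen 2) — first-lemma signatures for the crux ideas
`linking-budget-enclosing-pairs` (filed) on crux `NoFoldBound` (stmt-CriticalPhenomena-8296, route SAWDevelopingMap),
plus the exact identity `TurnProfileInvisible` and the definition `portAmplitude` recorded in Ideator3g2Evidence.md §3
(the three-port candidate was NOT filed: coherent port phases are not the worst case). Statements only (Props).
-/

open Literature.Probability.LatticeModels Literature.Probability.RandomPlanarGeometry.SAW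

namespace Summit.CriticalPhenomena.SAWScalingLimit.Cruxes.NoFoldBound.Ideator3g2

noncomputable section
open scoped BigOperators
open Classical

/-- `α_T = 1 + 2 x_c cos(5π/24)`: monopole weight of a bare first arrival (DCS pair/triplet constants). -/
def alphaT : ℝ := 1 + 2 * hexCriticalFugacity * Real.cos (5 * Real.pi / 24)
/-- `β_T = 1 + 2 x_c cos(11π/24)`: Beltrami weight of a bare first arrival. -/
def betaT : ℝ := 1 + 2 * hexCriticalFugacity * Real.cos (11 * Real.pi / 24)

/-- Card 1, lemma L0 (exact, `x = x_c` specific): `α_T sin 37.5° = β_T cos 7.5°`, equivalently the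
linking kernel takes the SAME value on class differences `0` and `±1`:
`α_T² cos 75° − β_T² cos 165° = α_T² − β_T²` ("adjacent-class pairs are free"). -/
def AdjacentPairsAreFree : Prop :=
  alphaT * Real.sin (5 * Real.pi / 24) = betaT * Real.cos (Real.pi / 24)

/-- The linking kernel `K(d) = α_T² cos(75° d) − β_T² cos(165° d)` on class differences `d ∈ ℤ`. -/
def linkKernel (d : ℤ) : ℝ :=
  alphaT ^ 2 * Real.cos (5 * Real.pi / 12 * d) - betaT ^ 2 * Real.cos (11 * Real.pi / 12 * d)

/-- `x_c`-mass of ordered PAIRS of first arrivals `(γ, γ')` at the vertex `v` (walks from the source `a`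
to a mid-edge `{v, ws i}` not passing through `v`) whose winding difference satisfies `P`
(first arrivals at one vertex have windings differing by multiples of `2π/3`; the integer
`d = (W_γ − W_γ')/(2π/3)` is the class difference = port offset + 3·(linking number around `v`)). -/
def pairMassAt (Λ : Finset HexVertex) (a : Sym2 HexVertex) (v : HexVertex) (ws : Fin 3 → HexVertex)
    (P : ℝ → Prop) : ℝ :=
  ∑ i : Fin 3, ∑ j : Fin 3, ∑ γ : HexMidEdgeSAW Λ a s(v, ws i), ∑ γ' : HexMidEdgeSAW Λ a s(v, ws j),
    if v ∉ γ.verts ∧ v ∉ γ'.verts ∧ P (γ.winding - γ'.winding)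
    then hexCriticalFugacity ^ (γ.length + γ'.length) else 0

/-- Card 1, target inequality (collar form): ENCLOSING-PAIR BUDGET. Within lattice depth `R` of the
complement, pairs of first arrivals two classes apart (`|W − W'| = 4π/3`: the two walks reach `v`
around opposite sides, their union links `v` once) carry at most `ρ < 1/3` of the mass of pairs at
most one class apart. With the exact kernel identity
`|F̂₀|² − |F̂₂|² = Σ_{γ,γ'} x_c^{ℓ+ℓ'} (A_γ A_γ' cos 75°d − B_γ B_γ' cos 165°d)` and `K(0) = K(±1) > 0`,
`K(±2) = −1.914 K(0)`, `K(±3) = −0.707 K(0)`, this (plus the analogous smaller `|d| = 3` term) gives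
`NoFoldBound` on the collar; numerically the left side is ≤ 0.12 × the right side on all domains ≤ 30
vertices (14,299 vertices, all sources). -/
def CollarEnclosingPairBudget (R : ℝ) : Prop :=
  ∃ ρ : ℝ, ρ < 1 / 3 ∧ ∀ (Λ : Finset HexVertex), hexDomainSimplyConnected Λ →
    ∀ a ∈ hexDomainBoundary Λ, ∀ v ∈ Λ,
    (∃ u : HexVertex, u ∉ Λ ∧ dist (hexCenter u) (hexCenter v) ≤ R) →
    ∀ ws : Fin 3 → HexVertex, (∀ i, hexGraph.Adj v (ws i)) → Function.Injective ws →
      pairMassAt Λ a v ws (fun t => |t| = 4 * Real.pi / 3)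
        ≤ ρ * pairMassAt Λ a v ws (fun t => |t| ≤ 2 * Real.pi / 3)

/-- Evidence §3 (exact, not a filed card): for a PRODUCT class law `w_{i+3m} = π_i r_m` (port profile × turn-number
profile) the turn-number profile is invisible to the fold ratio:
`|ŵ(165°)| · |Π(75°)| = |ŵ(75°)| · |Π(165°)|`, because `3 · 75° ≡ −(3 · 165°) (mod 360°)`. -/
def TurnProfileInvisible : Prop :=
  ∀ (π : Fin 3 → ℝ) (S : Finset ℤ) (r : ℤ → ℝ),
    let w : ℝ → ℂ := fun t => ∑ i : Fin 3, ∑ m ∈ S,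
      ((π i * r m : ℝ) : ℂ) * Complex.exp (-Complex.I * (t : ℂ) * (((i : ℕ) : ℂ) + 3 * (m : ℂ)))
    let P : ℝ → ℂ := fun t => ∑ i : Fin 3, ((π i : ℝ) : ℂ) * Complex.exp (-Complex.I * (t : ℂ) * ((i : ℕ) : ℂ))
    ‖w (11 * Real.pi / 12)‖ * ‖P (5 * Real.pi / 12)‖ = ‖w (5 * Real.pi / 12)‖ * ‖P (11 * Real.pi / 12)‖

/-- The complex first-arrival amplitude of the port `{v, w}` of `v`: walks from the source `a` to the
mid-edge `{v, w}` that do not pass through `v`, weighted `x_c^ℓ e^{−i(5/8)W}`. -/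
def portAmplitude (Λ : Finset HexVertex) (a : Sym2 HexVertex) (v w : HexVertex) : ℂ :=
  ∑ γ : HexMidEdgeSAW Λ a s(v, w), if v ∉ γ.verts then γ.weight hexCriticalFugacity (5 / 8) else 0

end

end Summit.CriticalPhenomena.SAWScalingLimit.Cruxes.NoFoldBound.Ideator3g2
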